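import Literature.AlgebraicGeometry.VanGeemen1994.WeilTypeHodgeRingOfSU
import HarnessLib

/-!
# Crux X3 `CYFormSquarePrinciple` (route `CYFormCasimir`, stmt-HodgeConjecture-23494), helper file 2:
# the test pull-backs `(x·𝟙 + y·φ)^*` on the monomial basis of `H•(A(ℂ); ℂ)` and the Weil lines
# `⋀⁴W`, `⋀⁴W^*` of an eightfold in coordinates

research route conditional on HC_CM; not a corollary. Nothing here proves HC, HC_CM or any rung.

For a complex abelian variety `A` of dimension `2n` with `φ ≫ φ = -d` and the Weil basis
`bW = (w₁,…,w_{2n}, w*₁,…,w*_{2n})` of `H¹(A(ℂ); ℂ) = W ⊕ W^*` of the tree's `VanGeemen1994.WeilTypeHodgeRingOfSU`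
(monomial bases `monB bW q` of `H^q`), the test pull-back `(x·𝟙 + y·φ)^*` is DIAGONAL on the monomials:
`(x·𝟙 + y·φ)^* b_s = (x + iy√d)^{a(s)} (x - iy√d)^{b(s)} b_s`, `a(s)`/`b(s)` the number of `w`/`w^*` factors
(`testOp_monB`; van Geemen LNM 1594, 4.9 and proof of Thm. 6.12: `(√-d)^*` acts on `⋀ᵃW ⊗ ⋀ᵇW^*` by a
character). Consequences for `n = 4` in degree `4`: the joint eigenclass spaces of the crux,
`weilClassesPlus A φ 2 d` (`⋀⁴W`) and `weilClassesMinus A φ 2 d` (`⋀⁴W^*`), have vanishing coordinates at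
every monomial with a `w^*` (resp. `w`) factor (`repr_eq_zero_of_mem_weilClassesPlus_two`, `…Minus_two`;
separation at the test endomorphism `𝟙 + 2φ`: `(1 + 2i√d)^m ≠ (1 - 2i√d)^m`, `1 ≤ m ≤ 4`), and are spanned
by the pure monomials (`monB_mem_weilClassesPlus_two`, `weilClassesPlus_two_le_span`, `…Minus…`).

References: vanGeemen1994HodgeAV (4.8–4.9, proof of Thm. 6.12), HatcherAT2002 (§3.2 Prop. 3.10, Example 3.16).
-/
-- `Summit.HodgeConjecture.HodgeConjecture.…` is the tree's mandated summit/problem namespace (single-problem summit).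
set_option linter.dupNamespace false
noncomputable section

open CategoryTheory
open Literature.AlgebraicTopology.SingularHomology
open Literature.AlgebraicGeometry.Motives
open Literature.AlgebraicGeometry.HodgeTheory
open Literature.AlgebraicGeometry.VanGeemen1994

namespace Summit.HodgeConjecture.HodgeConjecture.Theorems.CYFormSquare

/-! ### Generic linear algebra and index combinatorics -/
/-- **Coordinates under a diagonal operator**: if `L (B i) = εᵢ • B i` for a basis `B` then the `i`-th
coordinate of `L z` is `εᵢ` times that of `z`. [folklore] -/
theorem repr_apply_of_diagonal {ι M : Type*} [Fintype ι] [DecidableEq ι] [AddCommGroup M] [Module ℂ M]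
    (B : Module.Basis ι ℂ M) (L : M →ₗ[ℂ] M) (ε : ι → ℂ) (hL : ∀ i, L (B i) = ε i • B i) (z : M) (i : ι) :
    B.repr (L z) i = ε i * B.repr z i := by
  conv_lhs => rw [← B.sum_repr z, map_sum]
  simp_rw [map_smul, hL, smul_smul, map_sum, map_smul, B.repr_self, Finsupp.smul_single, smul_eq_mul, mul_one]
  rw [Finset.sum_apply', Finset.sum_eq_single i]
  · rw [Finsupp.single_eq_same, mul_comm]
  · intro j _ hj
    rw [Finsupp.single_apply, if_neg hj]
  · intro h; exact absurd (Finset.mem_univ i) h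

/-- The product over an index set `s ⊆ Fin (k + k)` of a function that is constant `α` on the first block
and constant `β` on the second block is `α^{a(s)} β^{b(s)}`, `a(s)` (resp. `b(s)`) the number of first-block (resp. second-block)
indices in `s`. [folklore] -/
theorem prod_addCases_const {k : ℕ} (s : Finset (Fin (k + k))) (α β : ℂ) :
    ∏ j ∈ s, (Fin.addCases (fun _ : Fin k ↦ α) (fun _ : Fin k ↦ β) j : ℂ) =
      α ^ (projW s).card * β ^ (Finset.univ.filter fun j : Fin k ↦ Fin.natAdd k j ∈ s).card := by
  classical
  have h1 : ∏ j ∈ s, (Fin.addCases (fun _ : Fin k ↦ α) (fun _ : Fin k ↦ β) j : ℂ) =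
      ∏ j : Fin (k + k), (if j ∈ s then (Fin.addCases (fun _ : Fin k ↦ α) (fun _ : Fin k ↦ β) j : ℂ) else 1) := by
    rw [Finset.prod_ite_mem, Finset.univ_inter]
  rw [h1, Fin.prod_univ_add]
  simp only [Fin.addCases_left, Fin.addCases_right]
  rw [Finset.prod_ite, Finset.prod_const, Finset.prod_const_one, mul_one, Finset.prod_ite, Finset.prod_const,
    Finset.prod_const_one, mul_one]
  rfl

/-- Every index of `Fin (k + k)` is in the first or in the second block, so
`#s = a(s) + b(s)`. [folklore] -/
theorem card_eq_card_projW_add {k : ℕ} (s : Finset (Fin (k + k))) :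
    s.card = (projW s).card + (Finset.univ.filter fun j : Fin k ↦ Fin.natAdd k j ∈ s).card := by
  classical
  have h := prod_addCases_const s (2 : ℂ) 2
  rw [← pow_add] at h
  have h2 : ∏ j ∈ s, (Fin.addCases (fun _ : Fin k ↦ (2 : ℂ)) (fun _ : Fin k ↦ (2 : ℂ)) j : ℂ) = 2 ^ s.card := by
    rw [← Finset.prod_const]
    refine Finset.prod_congr rfl fun j _ ↦ ?_
    exact Fin.addCases (fun i ↦ by rw [Fin.addCases_left]) (fun i ↦ by rw [Fin.addCases_right]) j
  rw [h2] at h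
  have h' : ((2 ^ s.card : ℕ) : ℂ) =
      ((2 ^ ((projW s).card + (Finset.univ.filter fun j : Fin k ↦ Fin.natAdd k j ∈ s).card) : ℕ) : ℂ) := by
    push_cast; exact h
  exact Nat.pow_right_injective (le_refl 2) (Nat.cast_injective h')

/-! ### Separation of the test characters at `𝟙 + 2φ` -/

/-- `√d ≠ 0` in `ℂ` for `d ≥ 1`. [folklore] -/
theorem sqrt_ne_zero_of_pos {d : ℕ} (hd : 0 < d) : (Real.sqrt d : ℂ) ≠ 0 := by
  rw [Ne, Complex.ofReal_eq_zero]
  exact (Real.sqrt_pos.mpr (by exact_mod_cast hd)).ne'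

/-- `(2i√d)² = -4d`. [folklore] -/
theorem two_I_sqrt_sq (d : ℕ) : (2 * Complex.I * (Real.sqrt d : ℂ)) ^ 2 = -(4 * (d : ℂ)) := by
  have hs : ((Real.sqrt d : ℂ)) ^ 2 = (d : ℂ) := by
    rw [← Complex.ofReal_pow, Real.sq_sqrt (Nat.cast_nonneg d)]
    push_cast; rfl
  calc (2 * Complex.I * (Real.sqrt d : ℂ)) ^ 2 = 4 * Complex.I ^ 2 * (Real.sqrt d : ℂ) ^ 2 := by ring
    _ = -(4 * (d : ℂ)) := by rw [Complex.I_sq, hs]; ring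

/-- **Separation**: `(1 + 2i√d)^m ≠ (1 - 2i√d)^m` for `1 ≤ m ≤ 4` and every `d ≥ 1` — the differences are
`2z`, `4z`, `2z(3 - 4d)`, `8z(1 - 4d)` with `z = 2i√d ≠ 0` and `4d ∉ {1, 3}`. Hence the characters
`(1 + 2i√d)^a (1 - 2i√d)^b`, `a + b = 4`, of the test endomorphism `𝟙 + 2φ` on `⋀ᵃW ⊗ ⋀ᵇW^*` are pairwise
distinct. [cite: vanGeemen1994HodgeAV, proof of Thm. 6.12] -/
theorem one_add_pow_ne_one_sub_pow {d : ℕ} (hd : 0 < d) {m : ℕ} (hm : 1 ≤ m) (hm4 : m ≤ 4) :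
    (1 + 2 * Complex.I * (Real.sqrt d : ℂ)) ^ m ≠ (1 - 2 * Complex.I * (Real.sqrt d : ℂ)) ^ m := by
  set z : ℂ := 2 * Complex.I * (Real.sqrt d : ℂ) with hz
  have hz0 : z ≠ 0 := mul_ne_zero (mul_ne_zero two_ne_zero Complex.I_ne_zero) (sqrt_ne_zero_of_pos hd)
  have hz2 : z ^ 2 = -(4 * (d : ℂ)) := two_I_sqrt_sq d
  have h3 : (3 : ℂ) - 4 * (d : ℂ) ≠ 0 := by
    intro h
    have h' : ((4 * d : ℕ) : ℂ) = ((3 : ℕ) : ℂ) := by push_cast; linear_combination -h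
    have := Nat.cast_injective (R := ℂ) h'
    omega
  have h1 : (1 : ℂ) - 4 * (d : ℂ) ≠ 0 := by
    intro h
    have h' : ((4 * d : ℕ) : ℂ) = ((1 : ℕ) : ℂ) := by push_cast; linear_combination -h
    have := Nat.cast_injective (R := ℂ) h'
    omega
  intro h
  rw [← sub_eq_zero] at h
  interval_cases m
  · have e : (1 + z) ^ 1 - (1 - z) ^ 1 = 2 * z := by ring
    rw [e] at h
    exact hz0 ((mul_eq_zero.1 h).resolve_left two_ne_zero)
  · have e : (1 + z) ^ 2 - (1 - z) ^ 2 = 4 * z := by ring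
    rw [e] at h
    exact hz0 ((mul_eq_zero.1 h).resolve_left (by norm_num))
  · have e : (1 + z) ^ 3 - (1 - z) ^ 3 = 2 * z * (3 + z ^ 2) := by ring
    rw [e, hz2, show (3 : ℂ) + -(4 * (d : ℂ)) = 3 - 4 * d by ring] at h
    rcases mul_eq_zero.1 h with h | h
    · exact hz0 ((mul_eq_zero.1 h).resolve_left two_ne_zero)
    · exact h3 h
  · have e : (1 + z) ^ 4 - (1 - z) ^ 4 = 8 * z * (1 + z ^ 2) := by ring
    rw [e, hz2, show (1 : ℂ) + -(4 * (d : ℂ)) = 1 - 4 * d by ring] at h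
    rcases mul_eq_zero.1 h with h | h
    · exact hz0 ((mul_eq_zero.1 h).resolve_left (by norm_num))
    · exact h1 h

/-- `1 + 2i√d ≠ 0` (real part `1`). [folklore] -/
theorem one_add_two_I_sqrt_ne_zero (d : ℕ) : (1 : ℂ) + 2 * Complex.I * (Real.sqrt d : ℂ) ≠ 0 := fun h ↦ by
  simpa using congrArg Complex.re h

/-- `1 - 2i√d ≠ 0` (real part `1`). [folklore] -/
theorem one_sub_two_I_sqrt_ne_zero (d : ℕ) : (1 : ℂ) - 2 * Complex.I * (Real.sqrt d : ℂ) ≠ 0 := fun h ↦ by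
  simpa using congrArg Complex.re h

/-- Membership in the first-block projection `projW s` (the tree's lemma is private). [folklore] -/
theorem mem_projW_iff {k : ℕ} {s : Finset (Fin (k + k))} {i : Fin k} : i ∈ projW s ↔ Fin.castAdd k i ∈ s := by
  simp [projW]

/-- `castAdd i ∈ castAdd(I) ↔ i ∈ I`. [folklore] -/
theorem castAdd_mem_map_castAddEmb_iff {k : ℕ} {I : Finset (Fin k)} {i : Fin k} :
    Fin.castAdd k i ∈ I.map (Fin.castAddEmb k) ↔ i ∈ I := by
  rw [Finset.mem_map]
  constructor
  · rintro ⟨j, hj, hji⟩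
    rwa [← Fin.castAdd_injective _ _ hji]
  · exact fun h ↦ ⟨i, h, rfl⟩

/-- `natAdd j ∈ natAdd(J) ↔ j ∈ J`. [folklore] -/
theorem natAdd_mem_map_natAddEmb_iff {k : ℕ} {J : Finset (Fin k)} {j : Fin k} :
    Fin.natAdd k j ∈ J.map (Fin.natAddEmb k) ↔ j ∈ J := by
  rw [Finset.mem_map]
  constructor
  · rintro ⟨i, hi, hij⟩
    rwa [← Fin.natAdd_injective _ _ hij]
  · exact fun h ↦ ⟨j, h, rfl⟩

/-- `castAdd i ≠ natAdd j`. [folklore] -/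
theorem castAdd_ne_natAdd' {k : ℕ} (i j : Fin k) : Fin.castAdd k i ≠ Fin.natAdd k j := by
  intro h
  have h' := congrArg Fin.val h
  rw [Fin.val_castAdd, Fin.val_natAdd] at h'
  have := i.2
  omega

/-- `castAdd i ∉ natAdd(J)`. [folklore] -/
theorem castAdd_not_mem_map_natAddEmb' {k : ℕ} {J : Finset (Fin k)} {i : Fin k} :
    Fin.castAdd k i ∉ J.map (Fin.natAddEmb k) := by
  rw [Finset.mem_map]
  rintro ⟨j, -, hj⟩
  exact castAdd_ne_natAdd' i j hj.symm

/-- `natAdd j ∉ castAdd(I)`. [folklore] -/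
theorem natAdd_not_mem_map_castAddEmb' {k : ℕ} {I : Finset (Fin k)} {j : Fin k} :
    Fin.natAdd k j ∉ I.map (Fin.castAddEmb k) := by
  rw [Finset.mem_map]
  rintro ⟨i, -, hi⟩
  exact castAdd_ne_natAdd' i j hi

/-- An index set without second-block indices is `castAdd` of its first-block projection. [folklore] -/
theorem eq_map_castAddEmb_projW {k : ℕ} {s : Finset (Fin (k + k))}
    (hs : (Finset.univ.filter fun j : Fin k ↦ Fin.natAdd k j ∈ s).card = 0) :
    s = (projW s).map (Fin.castAddEmb k) := by
  rw [Finset.card_eq_zero, Finset.filter_eq_empty_iff] at hs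
  ext j
  refine Fin.addCases (fun i ↦ ?_) (fun i ↦ ?_) j
  · rw [castAdd_mem_map_castAddEmb_iff, mem_projW_iff]
  · exact ⟨fun h ↦ absurd h (hs (Finset.mem_univ i)), fun h ↦ absurd h natAdd_not_mem_map_castAddEmb'⟩

/-- An index set without first-block indices is `natAdd` of its second-block projection. [folklore] -/
theorem eq_map_natAddEmb_filter {k : ℕ} {s : Finset (Fin (k + k))} (hs : (projW s).card = 0) :
    s = (Finset.univ.filter fun j : Fin k ↦ Fin.natAdd k j ∈ s).map (Fin.natAddEmb k) := by
  rw [Finset.card_eq_zero] at hs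
  ext j
  refine Fin.addCases (fun i ↦ ?_) (fun i ↦ ?_) j
  · have hi : Fin.castAdd k i ∉ s := fun h ↦ by
      have : i ∈ projW s := by rw [mem_projW_iff]; exact h
      rw [hs] at this; exact absurd this (Finset.notMem_empty i)
    exact ⟨fun h ↦ absurd h hi, fun h ↦ absurd h castAdd_not_mem_map_natAddEmb'⟩
  · rw [natAdd_mem_map_natAddEmb_iff, Finset.mem_filter]
    exact ⟨fun h ↦ ⟨Finset.mem_univ i, h⟩, fun h ↦ h.2⟩

/-! ### The test pull-backs on the monomial basis -/

section TestOperators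

variable {A : AbelianVariety ℂ} {n d : ℕ} {φ : A ⟶ A}
variable (hn : 2 ≤ n) (hd : 0 < d) (hA : A.dim = 2 * n) (hφ : φ ≫ φ = -(d • 𝟙 A))
  (e : ProjectiveEmbedding A.X) {a : complexBetti (projectiveSpace e.n ℂ) 2} (ha : IsRationalClass a)
  (ha0 : a ≠ 0)

/-- The test pull-back `(x·𝟙 + y·φ)^*` on `H^q(A(ℂ); ℂ)` is the exterior action of its degree-one component
(`exteriorPullback_map`: `f^*` is multiplicative). [cite: HatcherAT2002, §3.2 Prop. 3.10] -/
theorem testOp_eq_extAct (x y q : ℕ) :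
    (complexBetti.map (x • 𝟙 A + y • φ).hom.hom.hom q).hom =
      extAct (complexBetti.map (x • 𝟙 A + y • φ).hom.hom.hom 1).hom q :=
  (exteriorPullback_map (hasExteriorCohomologyH1 A)
    (Literature.AlgebraicGeometry.Motives.AlgPoints.mapContinuous (L := ℂ) (x • 𝟙 A + y • φ).hom.hom.hom) q).symm

/-- `(x·𝟙 + y·φ)^* wᵢ = (x + iy√d) wᵢ` on the first block of the Weil basis. [cite: vanGeemen1994HodgeAV, 4.9 and Lemma 6.10] -/
theorem testOp_bW_castAdd (x y : ℕ) (i : Fin (2 * n)) :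
    (complexBetti.map (x • 𝟙 A + y • φ).hom.hom.hom 1).hom (bW hn hd hA hφ e ha ha0 (Fin.castAdd (2 * n) i)) =
      ((x : ℂ) + (y : ℂ) * Complex.I * (Real.sqrt d : ℂ)) • bW hn hd hA hφ e ha ha0 (Fin.castAdd (2 * n) i) := by
  change complexBetti.map (x • 𝟙 A + y • φ).hom.hom.hom 1 _ = _
  rw [complexBetti_map_nsmul_id_add_nsmul_one φ x y]
  have h := pullbackOne_weilBasis_castAdd (m := 2 * n - 1) (by omega) (by omega) hd hφ e ha ha0 (wBasis hd hφ hA) i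
  change complexBetti.map φ.hom.hom.hom 1 (bW hn hd hA hφ e ha ha0 (Fin.castAdd (2 * n) i)) = _ at h
  rw [h, smul_smul, ← add_smul, mul_assoc]

/-- `(x·𝟙 + y·φ)^* w*ⱼ = (x - iy√d) w*ⱼ` on the second block of the Weil basis. [cite: vanGeemen1994HodgeAV, 4.9 and Lemma 6.10] -/
theorem testOp_bW_natAdd (x y : ℕ) (j : Fin (2 * n)) :
    (complexBetti.map (x • 𝟙 A + y • φ).hom.hom.hom 1).hom (bW hn hd hA hφ e ha ha0 (Fin.natAdd (2 * n) j)) =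
      ((x : ℂ) - (y : ℂ) * Complex.I * (Real.sqrt d : ℂ)) • bW hn hd hA hφ e ha ha0 (Fin.natAdd (2 * n) j) := by
  change complexBetti.map (x • 𝟙 A + y • φ).hom.hom.hom 1 _ = _
  rw [complexBetti_map_nsmul_id_add_nsmul_one φ x y]
  have h := pullbackOne_weilBasis_natAdd (m := 2 * n - 1) (by omega) (by omega) hd hφ e ha ha0 (wBasis hd hφ hA) j
  change complexBetti.map φ.hom.hom.hom 1 (bW hn hd hA hφ e ha ha0 (Fin.natAdd (2 * n) j)) = _ at h
  rw [h, smul_smul, ← add_smul, mul_neg, ← sub_eq_add_neg, mul_assoc]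

/-- **The test pull-backs are diagonal on the monomial basis**:
`(x·𝟙 + y·φ)^* b_s = (x + iy√d)^{a(s)} (x - iy√d)^{b(s)} b_s`, where `a(s) = #(projW s)` counts the `w`-factors
and `b(s)` the `w^*`-factors of the monomial `b_s` (van Geemen: `⋀ᵃW ⊗ ⋀ᵇW^*` is the `χ₊ᵃχ₋ᵇ`-eigenspace).
[cite: vanGeemen1994HodgeAV, 4.9 and proof of Thm. 6.12] -/
theorem testOp_monB (x y q : ℕ) (s : Set.powersetCard (Fin (2 * n + 2 * n)) q) :
    complexBetti.map (x • 𝟙 A + y • φ).hom.hom.hom q (monB (bW hn hd hA hφ e ha ha0) q s) =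
      (((x : ℂ) + (y : ℂ) * Complex.I * (Real.sqrt d : ℂ)) ^ (projW s.val).card *
        ((x : ℂ) - (y : ℂ) * Complex.I * (Real.sqrt d : ℂ)) ^
          (Finset.univ.filter fun j : Fin (2 * n) ↦ Fin.natAdd (2 * n) j ∈ s.val).card) •
      monB (bW hn hd hA hφ e ha ha0) q s := by
  change (complexBetti.map (x • 𝟙 A + y • φ).hom.hom.hom q).hom _ = _
  rw [testOp_eq_extAct, extAct_monB_of_diagonal (bW hn hd hA hφ e ha ha0) _
    (fun j ↦ Fin.addCases (fun _ : Fin (2 * n) ↦ (x : ℂ) + (y : ℂ) * Complex.I * (Real.sqrt d : ℂ))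
      (fun _ : Fin (2 * n) ↦ (x : ℂ) - (y : ℂ) * Complex.I * (Real.sqrt d : ℂ)) j), prod_addCases_const]
  intro j
  refine Fin.addCases (fun i ↦ ?_) (fun i ↦ ?_) j
  · rw [Fin.addCases_left]; exact testOp_bW_castAdd hn hd hA hφ e ha ha0 x y i
  · rw [Fin.addCases_right]; exact testOp_bW_natAdd hn hd hA hφ e ha ha0 x y i

/-- Coordinates under a test pull-back: `((x·𝟙 + y·φ)^* z)_s = χ₊ᵃ⁽ˢ⁾ χ₋ᵇ⁽ˢ⁾ · z_s`. [cite: vanGeemen1994HodgeAV, proof of Thm. 6.12] -/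
theorem repr_testOp (x y q : ℕ) (z : complexBetti A.X q) (s : Set.powersetCard (Fin (2 * n + 2 * n)) q) :
    (monB (bW hn hd hA hφ e ha ha0) q).repr (complexBetti.map (x • 𝟙 A + y • φ).hom.hom.hom q z) s =
      (((x : ℂ) + (y : ℂ) * Complex.I * (Real.sqrt d : ℂ)) ^ (projW s.val).card *
        ((x : ℂ) - (y : ℂ) * Complex.I * (Real.sqrt d : ℂ)) ^
          (Finset.univ.filter fun j : Fin (2 * n) ↦ Fin.natAdd (2 * n) j ∈ s.val).card) *
      (monB (bW hn hd hA hφ e ha ha0) q).repr z s :=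
  repr_apply_of_diagonal (monB (bW hn hd hA hφ e ha ha0) q) (complexBetti.map (x • 𝟙 A + y • φ).hom.hom.hom q).hom _
    (fun t ↦ testOp_monB hn hd hA hφ e ha ha0 x y q t) z s

/-! ### Degree `4`: the lines `⋀⁴W = E₊⁽⁴⁾`, `⋀⁴W^* = E₋⁽⁴⁾` of the crux in coordinates -/

/-- **A class of `E₊⁽⁴⁾ = weilClassesPlus A φ 2 d` has no coordinate at a monomial with a `w^*`-factor**
(test with `𝟙 + 2φ`: the eigenvalue `(1+2i√d)ᵃ(1-2i√d)ᵇ`, `b ≥ 1`, differs from `(1+2i√d)⁴`).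
[cite: vanGeemen1994HodgeAV, 4.9 and proof of Thm. 6.12] -/
theorem repr_eq_zero_of_mem_weilClassesPlus_two {c : complexBetti A.X (2 * 2)} (hc : c ∈ weilClassesPlus A φ 2 d)
    (s : Set.powersetCard (Fin (2 * n + 2 * n)) (2 * 2))
    (hs : (Finset.univ.filter fun j : Fin (2 * n) ↦ Fin.natAdd (2 * n) j ∈ s.val).card ≠ 0) :
    (monB (bW hn hd hA hφ e ha ha0) (2 * 2)).repr c s = 0 := by
  set α : ℂ := ((1 : ℕ) : ℂ) + ((2 : ℕ) : ℂ) * Complex.I * (Real.sqrt d : ℂ) with hα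
  set β : ℂ := ((1 : ℕ) : ℂ) - ((2 : ℕ) : ℂ) * Complex.I * (Real.sqrt d : ℂ) with hβ
  set p := (projW s.val).card with hp
  set q := (Finset.univ.filter fun j : Fin (2 * n) ↦ Fin.natAdd (2 * n) j ∈ s.val).card with hq
  have hpq : p + q = 2 * 2 := by rw [hp, hq, ← card_eq_card_projW_add]; exact s.prop
  have h1 := repr_testOp hn hd hA hφ e ha ha0 1 2 (2 * 2) c s
  rw [(mem_weilClassesPlus_iff.1 hc) 1 2, map_smul, Finsupp.smul_apply, smul_eq_mul] at h1
  -- `(α^4 - α^p β^q) c_s = 0`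
  have h2 : (α ^ (2 * 2) - α ^ p * β ^ q) * (monB (bW hn hd hA hφ e ha ha0) (2 * 2)).repr c s = 0 := by
    rw [sub_mul, h1, sub_self]
  refine (mul_eq_zero.1 h2).resolve_left (sub_ne_zero.2 fun h ↦ ?_)
  have hα0 : α ≠ 0 := by rw [hα]; push_cast; exact one_add_two_I_sqrt_ne_zero d
  have h3 : α ^ p * α ^ q = α ^ p * β ^ q := by rw [← pow_add, hpq, h]
  have h4 : α ^ q = β ^ q := mul_left_cancel₀ (pow_ne_zero _ hα0) h3
  have hq1 : 1 ≤ q := Nat.one_le_iff_ne_zero.2 hs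
  have hq4 : q ≤ 4 := by omega
  refine one_add_pow_ne_one_sub_pow hd hq1 hq4 ?_
  rw [hα, hβ] at h4; push_cast at h4; exact h4

/-- **A class of `E₋⁽⁴⁾ = weilClassesMinus A φ 2 d` has no coordinate at a monomial with a `w`-factor.**
[cite: vanGeemen1994HodgeAV, 4.9 and proof of Thm. 6.12] -/
theorem repr_eq_zero_of_mem_weilClassesMinus_two {c : complexBetti A.X (2 * 2)} (hc : c ∈ weilClassesMinus A φ 2 d)
    (s : Set.powersetCard (Fin (2 * n + 2 * n)) (2 * 2)) (hs : (projW s.val).card ≠ 0) :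
    (monB (bW hn hd hA hφ e ha ha0) (2 * 2)).repr c s = 0 := by
  set α : ℂ := ((1 : ℕ) : ℂ) + ((2 : ℕ) : ℂ) * Complex.I * (Real.sqrt d : ℂ) with hα
  set β : ℂ := ((1 : ℕ) : ℂ) - ((2 : ℕ) : ℂ) * Complex.I * (Real.sqrt d : ℂ) with hβ
  set p := (projW s.val).card with hp
  set q := (Finset.univ.filter fun j : Fin (2 * n) ↦ Fin.natAdd (2 * n) j ∈ s.val).card with hq
  have hpq : p + q = 2 * 2 := by rw [hp, hq, ← card_eq_card_projW_add]; exact s.prop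
  have h1 := repr_testOp hn hd hA hφ e ha ha0 1 2 (2 * 2) c s
  rw [(mem_weilClassesMinus_iff.1 hc) 1 2, map_smul, Finsupp.smul_apply, smul_eq_mul] at h1
  have h2 : (β ^ (2 * 2) - α ^ p * β ^ q) * (monB (bW hn hd hA hφ e ha ha0) (2 * 2)).repr c s = 0 := by
    rw [sub_mul, h1, sub_self]
  refine (mul_eq_zero.1 h2).resolve_left (sub_ne_zero.2 fun h ↦ ?_)
  have hβ0 : β ≠ 0 := by rw [hβ]; push_cast; exact one_sub_two_I_sqrt_ne_zero d
  have h3 : β ^ p * β ^ q = α ^ p * β ^ q := by rw [← pow_add, hpq, h]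
  have h4 : β ^ p = α ^ p := mul_right_cancel₀ (pow_ne_zero _ hβ0) h3
  have hp1 : 1 ≤ p := Nat.one_le_iff_ne_zero.2 hs
  have hp4 : p ≤ 4 := by omega
  refine one_add_pow_ne_one_sub_pow hd hp1 hp4 ?_
  rw [hα, hβ] at h4; push_cast at h4; exact h4.symm

/-- A monomial without `w^*`-factors lies in `E₊⁽⁴⁾ = ⋀⁴W`. [cite: vanGeemen1994HodgeAV, proof of Thm. 6.12] -/
theorem monB_mem_weilClassesPlus_two (s : Set.powersetCard (Fin (2 * n + 2 * n)) (2 * 2))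
    (hs : (Finset.univ.filter fun j : Fin (2 * n) ↦ Fin.natAdd (2 * n) j ∈ s.val).card = 0) :
    monB (bW hn hd hA hφ e ha ha0) (2 * 2) s ∈ weilClassesPlus A φ 2 d := by
  rw [mem_weilClassesPlus_iff]
  intro x y
  have h := testOp_monB hn hd hA hφ e ha ha0 x y (2 * 2) s
  have hp : (projW s.val).card = 2 * 2 := by
    have := card_eq_card_projW_add s.val; rw [hs, add_zero, s.prop] at this; exact this.symm
  rw [hs, hp, pow_zero, mul_one] at h
  exact h

/-- A monomial without `w`-factors lies in `E₋⁽⁴⁾ = ⋀⁴W^*`. [cite: vanGeemen1994HodgeAV, proof of Thm. 6.12] -/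
theorem monB_mem_weilClassesMinus_two (s : Set.powersetCard (Fin (2 * n + 2 * n)) (2 * 2))
    (hs : (projW s.val).card = 0) :
    monB (bW hn hd hA hφ e ha ha0) (2 * 2) s ∈ weilClassesMinus A φ 2 d := by
  rw [mem_weilClassesMinus_iff]
  intro x y
  have h := testOp_monB hn hd hA hφ e ha ha0 x y (2 * 2) s
  have hq : (Finset.univ.filter fun j : Fin (2 * n) ↦ Fin.natAdd (2 * n) j ∈ s.val).card = 2 * 2 := by
    have := card_eq_card_projW_add s.val; rw [hs, zero_add, s.prop] at this; exact this.symm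
  rw [hs, hq, pow_zero, one_mul] at h
  exact h

/-- **`E₊⁽⁴⁾` is spanned by the monomials in the `w`'s**: every class of `weilClassesPlus A φ 2 d` lies in the
span of the monomials `b_{castAdd(I)}`, `I` a `4`-subset of the first block. [cite: vanGeemen1994HodgeAV, proof of Thm. 6.12] -/
theorem weilClassesPlus_two_le_span :
    weilClassesPlus A φ 2 d ≤ Submodule.span ℂ (Set.range fun I : Set.powersetCard (Fin (2 * n)) (2 * 2) ↦
      monB (bW hn hd hA hφ e ha ha0) (2 * 2) (Set.powersetCard.map (2 * 2) (Fin.castAddEmb (2 * n)) I)) := by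
  classical
  intro c hc
  set B := monB (bW hn hd hA hφ e ha ha0) (2 * 2) with hB
  rw [← B.sum_repr c]
  refine Submodule.sum_mem _ fun s _ ↦ ?_
  by_cases hs : (Finset.univ.filter fun j : Fin (2 * n) ↦ Fin.natAdd (2 * n) j ∈ s.val).card = 0
  · -- `s = castAdd (projW s)`
    have hcard : (projW s.val).card = 2 * 2 := by
      have := card_eq_card_projW_add s.val; rw [hs, add_zero, s.prop] at this; exact this.symm
    have hst : Set.powersetCard.map (2 * 2) (Fin.castAddEmb (2 * n)) (Set.powersetCard.ofCard hcard) = s :=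
      Subtype.ext (by rw [Set.powersetCard.val_map, Set.powersetCard.val_ofCard]; exact (eq_map_castAddEmb_projW hs).symm)
    refine Submodule.smul_mem _ _ (Submodule.subset_span ⟨Set.powersetCard.ofCard hcard, ?_⟩)
    change monB (bW hn hd hA hφ e ha ha0) (2 * 2) _ = B s
    rw [hst]
  · rw [repr_eq_zero_of_mem_weilClassesPlus_two hn hd hA hφ e ha ha0 hc s hs, zero_smul]
    exact Submodule.zero_mem _

/-- **`E₋⁽⁴⁾` is spanned by the monomials in the `w^*`'s.** [cite: vanGeemen1994HodgeAV, proof of Thm. 6.12] -/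
theorem weilClassesMinus_two_le_span :
    weilClassesMinus A φ 2 d ≤ Submodule.span ℂ (Set.range fun J : Set.powersetCard (Fin (2 * n)) (2 * 2) ↦
      monB (bW hn hd hA hφ e ha ha0) (2 * 2) (Set.powersetCard.map (2 * 2) (Fin.natAddEmb (2 * n)) J)) := by
  classical
  intro c hc
  set B := monB (bW hn hd hA hφ e ha ha0) (2 * 2) with hB
  rw [← B.sum_repr c]
  refine Submodule.sum_mem _ fun s _ ↦ ?_
  by_cases hs : (projW s.val).card = 0
  · have hcard : (Finset.univ.filter fun j : Fin (2 * n) ↦ Fin.natAdd (2 * n) j ∈ s.val).card = 2 * 2 := by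
      have := card_eq_card_projW_add s.val; rw [hs, zero_add, s.prop] at this; exact this.symm
    have hst : Set.powersetCard.map (2 * 2) (Fin.natAddEmb (2 * n)) (Set.powersetCard.ofCard hcard) = s :=
      Subtype.ext (by rw [Set.powersetCard.val_map, Set.powersetCard.val_ofCard]; exact (eq_map_natAddEmb_filter hs).symm)
    refine Submodule.smul_mem _ _ (Submodule.subset_span ⟨Set.powersetCard.ofCard hcard, ?_⟩)
    change monB (bW hn hd hA hφ e ha ha0) (2 * 2) _ = B s
    rw [hst]
  · rw [repr_eq_zero_of_mem_weilClassesMinus_two hn hd hA hφ e ha ha0 hc s hs, zero_smul]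
    exact Submodule.zero_mem _

end TestOperators

end Summit.HodgeConjecture.HodgeConjecture.Theorems.CYFormSquare

end
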